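import Summits.QuantumFields.BalabanUV.Beta.D1BFx.SymHessTablePairMass
import Summits.QuantumFields.BalabanUV.Beta.D1BFx.PackedStraightColumnMixedMass

/-!
# `BalabanUV.Beta.D1BFx.SymHessTableMass` — road «BF-x» for binder row D1, slot (K) ∕ junction (J1), PART 24 HEAD rows with the multiplier-leg vertex
# `V_H = vertexOfM K₀ n (symHessFFAt ρ_c n)`, «H-TABLE-MASS» PART B: **the packed table `symHessFFAt ρ L μ y` in WEIGHTED `ℓ¹` currency — the `hMs ∕ hMm` sockets of
# g61 C′ `mass_blk_vertexOfM_K₀_le` with the letter `2·ell²·e^{σ·4(d+1)L}` — and the (M-b) block masses of `V_H` at the record: NET `n⁻⁸ × 2·ell(4,n)² × CΦ`, NO lattice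
# volume at a fine rate (against the `Zl`-route's `n⁻⁸ × (≍ n⁸·ell²) × CΦ`)**

HONEST DEPENDENCY (cell records, verbatim): «continuum YM on T⁴ ⇐ BetaPertH ∧ nine spine estimates (0/9 proved); BetaPertH ⇐ (D1) ∧ (D4) ∧
CAP+tail; G-an2-4 gates asym, D1 and NE2/3/4.»  HONEST FRAMING (cell contract, verbatim): «discharging `BetaPertH` makes Bałaban's UV stability
UNCONDITIONAL — a real constructive-QFT result; it is NOT the continuum limit and NOT the Clay problem.»  THIS MODULE DISCHARGES NOTHING of the
wall: [folklore] `Finset` ∕ `tsum` bookkeeping BY NAME over PART A `SymHessTablePairMass.sum_sum_abs_symHessKerAt_le` (the pair mass `2ℓ²`), an1's `symHessFFAt ∕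
symHessKerAt_eq_zero_left∕right` (finite support), lit `nearSet ∕ near_zero_iff ∕ l1_le_of_near ∕ near_self`, and this lineage's g61 C′ «K0-MULT-MASS»
`PackedStraightColumnMixedMass.mass_blk_vertexOfM_K₀_le` (§5).  No definition, no `def … : Prop`, nothing cited, 0 sorry; `hΦ` (the SHAPE of d4-p3's `exists_wΦ_decay`)
stays DISPLAYED in §5.  A TABLE ∕ VERTEX MASS LETTER: it prices NO word and proves NO (1.22) row; 0 root-level binders of row D1 discharged; (J1) ONE OPEN ROW; (K) NOT
closed; NOT D1, NEVER «G-an2-4 closed», NOT `BetaPertH`, NOT continuum, NOT Clay.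

ABSOLUTE RULE (cell charter, verbatim): «No internally-minted statement may enter as a cited fact. Every hypothesis is either kernel-proved in
this package or a verbatim quotation of a PUBLISHED theorem with page reference. The manuscript(s) under audit are NOT citable for their own
disputed steps — they are the thing under adjudication; programme-internal (2001/route/tribunal) claims are never citable.»

CONTENT.
* §4 [folklore, `d + 1`, box root]: `blk_symHessFFAt_eq_zero ∕ _tt`, `mem_image_nearSet'`, `wfibreMass_blk_symHessFFAt_eq_zero` (finite support in the site pair),
  **`summable_wfibreMass_blk_symHessFFAt`** (g61's `hMs`), **`tsum_wfibreMass_blk_symHessFFAt_le`** (g61's `hMm`: `≤ if j ∧ k then 2·ell(d+1,L)²·e^{σ·4(d+1)L} else 0`, any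
  `0 ≤ σ`: PART A's pair mass against the weight's sup on the support box).
* §5 [our objects, `d = 3`, `[NeZero n]`]: **`wmass_blk_vertexOfM_K₀_symHessFFAt_le`** — every block of `V_H ν y′ = vertexOfM K₀ n (symHessFFAt (ctr 4 n) n) ν y′` has its
  `n•y′`-centred `σ`-weighted fibre mass summable and `≤ ((n⁵)⁻¹(n³)⁻¹)·(4CΦe^{κ₀}e^{κ₀∕2}Zl 4 (κ₀∕8))·(if j ∧ k then 2·ell(4,n)²·e^{σ·4·(4n)} else 0)` (modulo `hΦ`;
  `0 ≤ σ ≤ κ₀∕(16n)`) — the `MV` socket of d1-leaf-03's TT27a `decay510_bracketWord_of_wmass` and of every `σ`-weighted consumer of `V_H`; `exp_weight_le_of_rate`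
  (`σ ≤ κ₀∕(16n) ⟹ e^{σ·16n} ≤ e^{κ₀}`: the letter is then `2·ell(4,n)²·e^{κ₀} = 200n²e^{κ₀}`).
NOT HERE (honest): any row; `CΦ`'s value; m-uniformity of anything.
Unit `b2b-balaban-gan24-formalise-leaf-05` (gen 63), G-an2-4 swarm leaf prover 05, road «BF-x» supplier; INTENT-4 «H-TABLE-MASS» (journal).  Not in print; our bookkeeping.
No existing file touched.
-/

noncomputable section

open Finset
open scoped BigOperators Nat
open Literature.MathematicalPhysics.QuantumFieldTheory
open Literature.MathematicalPhysics.QuantumFieldTheory.Balaban1983to89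
open Literature.MathematicalPhysics.QuantumFieldTheory.Balaban1983to89.Beta
open Literature.MathematicalPhysics.QuantumFieldTheory.Balaban1983to89.Beta.AffineAveraging
open Literature.MathematicalPhysics.QuantumFieldTheory.Balaban1983to89.Beta.TransportedContourVariables
open Literature.MathematicalPhysics.QuantumFieldTheory.Balaban1983to89.Beta.AveragingHessianKernels

open Summit.QuantumFields.BalabanUV.Beta.D1BFx.SymHessTablePairMass (sum_sum_abs_symHessKerAt_le)

namespace Summit.QuantumFields.BalabanUV.Beta.D1BFx.SymHessTableMass

variable {d : ℕ}

/-! ## §4 The packed table `symHessFFAt ρ L μ y` in WEIGHTED `ℓ¹` currency: the `hMs ∕ hMm` sockets of g61 C′ `PackedStraightColumnMixedMass.mass_blk_vertexOfM_K₀_le` -/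

section Packed

open Summit.QuantumFields.BalabanUV.Beta.SymAveragingHessianCounts (symHessFFAt symHessKerAt symHessKerAt_eq_zero_left symHessKerAt_eq_zero_right
  symHessFFAt_inl_inl symHessFFAt_inl_inr symHessFFAt_inr)
open Summit.QuantumFields.BalabanUV.Beta.D1BFx.PackedKernelSplit (blk)
open Literature.MathematicalPhysics.QuantumFieldTheory.Balaban1983to89.Beta.AveragingMixedJetTables (nearSet mem_nearSet near_zero_iff)
open B12Sec2to5 (l1 l1_nonneg)

variable {L : ℕ} {r : Fin (d + 1) → ℕ}

/-- [folklore] Off the field–field block the packed Hessian table vanishes. -/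
theorem blk_symHessFFAt_eq_zero (ρ : Fin (d + 1) → ℤ) (L : ℕ) (μ : Fin (d + 1)) (y : Fin (d + 1) → ℤ) {j k : Bool} (h : ¬ (j = true ∧ k = true)) :
    blk (symHessFFAt ρ L μ y) j k = 0 := by
  funext x x' a b
  cases j <;> cases k
  · rfl
  · rfl
  · rfl
  · exact absurd ⟨rfl, rfl⟩ h

/-- [folklore] The field–field block of the packed Hessian table, entrywise. -/
theorem blk_symHessFFAt_tt (ρ : Fin (d + 1) → ℤ) (L : ℕ) (μ : Fin (d + 1)) (y : Fin (d + 1) → ℤ) (x x' : Fin (d + 1) → ℤ) (α α' : Fin (d + 1)) :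
    blk (symHessFFAt ρ L μ y) true true x x' α α' = symHessKerAt ρ L μ y (α, x) (α', x') := rfl

/-- [folklore] The support box of the block `y` as a `Finset` (translate of lit `nearSet`). -/
theorem mem_image_nearSet' {y x : Fin (d + 1) → ℤ} :
    x ∈ (nearSet (d + 1) L).image (fun x₀ => x₀ + (L : ℤ) • y) ↔ Near L y x := by
  constructor
  · rintro hx
    obtain ⟨x₀, hx₀, rfl⟩ := Finset.mem_image.1 hx
    have h := mem_nearSet.1 hx₀
    rw [← near_zero_iff (y := y)]
    simpa using h
  · intro hx
    refine Finset.mem_image.2 ⟨x + -((L : ℤ) • y), mem_nearSet.2 (near_zero_iff.2 hx), ?_⟩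
    simp

/-- [folklore] **FINITE SUPPORT**: the weighted fibre mass of every block of `symHessFFAt (toSite r) L μ y` vanishes off `near(y) × near(y)`. -/
theorem wfibreMass_blk_symHessFFAt_eq_zero (hr : r ∈ box (d + 1) L) (μ : Fin (d + 1)) (y : Fin (d + 1) → ℤ) (j k : Bool) (w : Site (d + 1) × Site (d + 1) → ℝ)
    {p : Site (d + 1) × Site (d + 1)}
    (hp : p ∉ (nearSet (d + 1) L).image (fun x₀ => x₀ + (L : ℤ) • y) ×ˢ (nearSet (d + 1) L).image (fun x₀ => x₀ + (L : ℤ) • y)) :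
    ∑ g : Fin (d + 1), ∑ f : Fin (d + 1), |blk (symHessFFAt (toSite r) L μ y) j k p.1 p.2 g f| * w p = 0 := by
  by_cases hjk : j = true ∧ k = true
  · obtain ⟨rfl, rfl⟩ := hjk
    rw [Finset.mem_product, not_and_or, mem_image_nearSet', mem_image_nearSet'] at hp
    refine Finset.sum_eq_zero fun g _ => Finset.sum_eq_zero fun f _ => ?_
    rw [blk_symHessFFAt_tt]
    rcases hp with h1 | h2
    · rw [symHessKerAt_eq_zero_left hr (f := (g, p.1)) h1, abs_zero, zero_mul]
    · rw [symHessKerAt_eq_zero_right hr _ (f' := (f, p.2)) h2, abs_zero, zero_mul]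
  · simp [blk_symHessFFAt_eq_zero (toSite r) L μ y hjk]

/-- [folklore] **`hMs` FOR THE HESSIAN TABLE**: every block's centred `σ`-weighted fibre mass is summable (finite support). -/
theorem summable_wfibreMass_blk_symHessFFAt (hr : r ∈ box (d + 1) L) (σ : ℝ) (μ : Fin (d + 1)) (y : Fin (d + 1) → ℤ) (j k : Bool) :
    Summable fun p : Site (d + 1) × Site (d + 1) => ∑ g : Fin (d + 1), ∑ f : Fin (d + 1),
      |blk (symHessFFAt (toSite r) L μ y) j k p.1 p.2 g f| * Real.exp (σ * (l1 (p.1 - (L : ℤ) • y) + l1 (p.2 - (L : ℤ) • y))) :=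
  summable_of_ne_finset_zero fun _ hp =>
    wfibreMass_blk_symHessFFAt_eq_zero hr μ y j k (fun p => Real.exp (σ * (l1 (p.1 - (L : ℤ) • y) + l1 (p.2 - (L : ℤ) • y)))) hp

/-- [folklore] **`hMm` FOR THE HESSIAN TABLE, WITH THE PAIR MASS `2ℓ²`**: for `0 ≤ σ`, every block's centred `σ`-weighted fibre mass of `symHessFFAt (toSite r) L μ y` is
`≤ (if j ∧ k then 2·ℓ²·e^{σ·4(d+1)L} else 0)` — §3's pair mass against the weight's sup on the support box (`l1_le_of_near`). -/
theorem tsum_wfibreMass_blk_symHessFFAt_le (hL : 1 ≤ L) (hr : r ∈ box (d + 1) L) {σ : ℝ} (hσ : 0 ≤ σ) (μ : Fin (d + 1)) (y : Fin (d + 1) → ℤ)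
    (j k : Bool) :
    ∑' p : Site (d + 1) × Site (d + 1), ∑ g : Fin (d + 1), ∑ f : Fin (d + 1),
        |blk (symHessFFAt (toSite r) L μ y) j k p.1 p.2 g f| * Real.exp (σ * (l1 (p.1 - (L : ℤ) • y) + l1 (p.2 - (L : ℤ) • y)))
      ≤ if j = true ∧ k = true then 2 * (ell (d + 1) L : ℝ) ^ 2 * Real.exp (σ * (4 * (((d : ℝ) + 1) * L))) else 0 := by
  classical
  set NS : Finset (Site (d + 1)) := (nearSet (d + 1) L).image (fun x₀ => x₀ + (L : ℤ) • y) with hNS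
  rw [tsum_eq_sum (s := NS ×ˢ NS) (fun p hp => wfibreMass_blk_symHessFFAt_eq_zero hr μ y j k
    (fun p => Real.exp (σ * (l1 (p.1 - (L : ℤ) • y) + l1 (p.2 - (L : ℤ) • y)))) (by rw [hNS] at hp; exact hp))]
  by_cases hjk : j = true ∧ k = true
  · obtain ⟨rfl, rfl⟩ := hjk
    rw [if_pos ⟨rfl, rfl⟩]
    set E : ℝ := Real.exp (σ * (4 * (((d : ℝ) + 1) * L))) with hE
    -- the weight on the support box
    have hw : ∀ p ∈ NS ×ˢ NS, Real.exp (σ * (l1 (p.1 - (L : ℤ) • y) + l1 (p.2 - (L : ℤ) • y))) ≤ E := by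
      intro p hp
      obtain ⟨h1, h2⟩ := Finset.mem_product.1 hp
      rw [hNS, mem_image_nearSet'] at h1 h2
      have d1 := l1_le_of_near h1 (near_self hL y)
      have d2 := l1_le_of_near h2 (near_self hL y)
      exact Real.exp_le_exp.2 (by nlinarith)
    -- the pair mass of the table on the support bonds
    have hmass : ∑ p ∈ NS ×ˢ NS, ∑ g : Fin (d + 1), ∑ f : Fin (d + 1), |symHessKerAt (toSite r) L μ y (g, p.1) (f, p.2)|
        ≤ 2 * (ell (d + 1) L : ℝ) ^ 2 := by
      have h := sum_sum_abs_symHessKerAt_le hL hr μ y (Finset.univ ×ˢ NS) (Finset.univ ×ˢ NS)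
      rw [Finset.sum_product_right] at h
      refine le_trans (le_of_eq ?_) h
      rw [Finset.sum_product]
      refine Finset.sum_congr rfl fun x _ => ?_
      rw [Finset.sum_comm]
      refine Finset.sum_congr rfl fun g _ => ?_
      rw [Finset.sum_product_right]
    calc ∑ p ∈ NS ×ˢ NS, ∑ g : Fin (d + 1), ∑ f : Fin (d + 1),
          |blk (symHessFFAt (toSite r) L μ y) true true p.1 p.2 g f| * Real.exp (σ * (l1 (p.1 - (L : ℤ) • y) + l1 (p.2 - (L : ℤ) • y)))
        ≤ ∑ p ∈ NS ×ˢ NS, ∑ g : Fin (d + 1), ∑ f : Fin (d + 1), |symHessKerAt (toSite r) L μ y (g, p.1) (f, p.2)| * E :=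
          Finset.sum_le_sum fun p hp => Finset.sum_le_sum fun g _ => Finset.sum_le_sum fun f _ => by
            rw [blk_symHessFFAt_tt]; exact mul_le_mul_of_nonneg_left (hw p hp) (abs_nonneg _)
      _ = (∑ p ∈ NS ×ˢ NS, ∑ g : Fin (d + 1), ∑ f : Fin (d + 1), |symHessKerAt (toSite r) L μ y (g, p.1) (f, p.2)|) * E := by
          rw [Finset.sum_mul]; refine Finset.sum_congr rfl fun p _ => ?_
          rw [Finset.sum_mul]; refine Finset.sum_congr rfl fun g _ => ?_
          rw [Finset.sum_mul]
      _ ≤ 2 * (ell (d + 1) L : ℝ) ^ 2 * E := mul_le_mul_of_nonneg_right hmass (Real.exp_pos _).le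
  · rw [if_neg hjk]
    refine le_of_eq (Finset.sum_eq_zero fun p _ => ?_)
    simp [blk_symHessFFAt_eq_zero (toSite r) L μ y hjk]

end Packed

/-! ## §5 `d = 3`, the record: the σ-weighted block masses of `V_H := vertexOfM K₀ n (symHessFFAt ρ_c n)` with the TABLE's PAIR MASS `2·ell(4,n)²` — NO lattice volume at a fine rate -/

section Record

open B12Sec2to5 (l1)
open B4ContourShift (supNorm)
open ExpKernelCalculus (Zl)
open KernelSpecInstance (wΦ)
open OneStepKernelFamily (KInvStep)
open SecondOrderResponse (vertexOfM)
open AveragingContoursRooted (ctr ctrOff ctrOff_mem_box)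
open Summit.QuantumFields.BalabanUV.Beta.SymAveragingHessianCounts (symHessFFAt)
open Summit.QuantumFields.BalabanUV.Beta.D1BFx.PackedKernelSplit (blk)
open Summit.QuantumFields.BalabanUV.Beta.D1BFx.PackedStraightColumnMixedMass (mass_blk_vertexOfM_K₀_le)

variable (n : ℕ) [NeZero n]

/-- [our objects + folklore] **«H-TABLE-MASS» AT THE RECORD — THE (M-b) BLOCK MASSES OF `V_H = vertexOfM K₀ n (symHessFFAt ρ_c n)` WITH THE TABLE READ IN `ℓ¹`**
(modulo the displayed multiplier envelope `hΦ`, `0 < κ₀`; `0 ≤ σ ≤ κ₀∕(16n)`): every block of `V_H ν y′` has its `n•y′`-centred `σ`-weighted fibre mass summable and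
`≤ ((n⁵)⁻¹·(n³)⁻¹)·(4·CΦ·e^{κ₀}·e^{κ₀∕2}·Zl 4 (κ₀∕8))·(if j ∧ k then 2·ell(4,n)²·e^{σ·4·(4n)} else 0)` — g61 C′ `mass_blk_vertexOfM_K₀_le` fed with §4's
`hMs ∕ hMm`; `e^{σ·16n} ≤ e^{κ₀}`.  Against the `Zl`-route through an1's `vertexFamily_symHessFFAt` (`mass_blk_vertexOfM_K₀_le_of_vertexFamily`:
`T = 16·(2·ell²·e^{16nδ})·Zl 4 (δ∕2)²` at a FINE rate `δ ≍ 1∕n`, i.e. `≍ n⁸·ell²`) the table now enters through its pair mass `2·ell(4,n)² = 200n²` ONCE: NET `n⁻⁸ × 200n² × CΦ`.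
The `hVA ∕ hVE`-type socket (`MV`) of d1-leaf-03's TT27a `decay510_bracketWord_of_wmass` and every other `σ`-weighted consumer of `V_H`. -/
theorem wmass_blk_vertexOfM_K₀_symHessFFAt_le {CΦ κ₀ : ℝ} (hκ₀ : 0 < κ₀)
    (hΦ : ∀ (ρ ν : Fin (3 + 1)) (w : Fin (3 + 1) → ℤ),
      |wΦ (N := n) ρ ν w| ≤ CΦ * ((n : ℝ) ^ 5)⁻¹ * ((n : ℝ) ^ 3)⁻¹ * Real.exp (-(κ₀ * supNorm w)))
    {σ : ℝ} (hσ0 : 0 ≤ σ) (hσ : σ ≤ κ₀ / (16 * (n : ℝ))) (ν : Fin (3 + 1)) (y' : Fin (3 + 1) → ℤ) (j k : Bool) :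
    (Summable fun p : Site (3 + 1) × Site (3 + 1) => ∑ g, ∑ f,
        |blk (vertexOfM (KInvStep (d := 3) n 0) n (symHessFFAt (ctr 4 n) n) ν y') j k p.1 p.2 g f|
          * Real.exp (σ * (l1 (p.1 - (n : ℤ) • y') + l1 (p.2 - (n : ℤ) • y')))) ∧
      ∑' p : Site (3 + 1) × Site (3 + 1), ∑ g, ∑ f,
          |blk (vertexOfM (KInvStep (d := 3) n 0) n (symHessFFAt (ctr 4 n) n) ν y') j k p.1 p.2 g f|
            * Real.exp (σ * (l1 (p.1 - (n : ℤ) • y') + l1 (p.2 - (n : ℤ) • y')))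
        ≤ (((n : ℝ) ^ 5)⁻¹ * ((n : ℝ) ^ 3)⁻¹) * (4 * CΦ * Real.exp κ₀ * Real.exp (κ₀ / 2) * Zl 4 (κ₀ / 8))
            * (if j = true ∧ k = true then 2 * (ell (3 + 1) n : ℝ) ^ 2 * Real.exp (σ * (4 * (((3 : ℝ) + 1) * n))) else 0) := by
  have hn : 1 ≤ n := Nat.one_le_iff_ne_zero.2 (NeZero.ne n)
  have hr := ctrOff_mem_box (d := 3 + 1) hn
  exact mass_blk_vertexOfM_K₀_le n hκ₀ hΦ hσ0 hσ ν y'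
    (fun ρ' w j' k' => summable_wfibreMass_blk_symHessFFAt hr σ ρ' w j' k')
    (fun ρ' w j' k' => tsum_wfibreMass_blk_symHessFFAt_le hn hr hσ0 ρ' w j' k') j k

/-- [folklore] The weight at the admissible rate: `σ ≤ κ₀∕(16n)` ⟹ `e^{σ·(4·(4·n))} ≤ e^{κ₀}` — the pair mass letter is then `2·ell(4,n)²·e^{κ₀}`, `n`-explicit and rate-free. -/
theorem exp_weight_le_of_rate {κ₀ σ : ℝ} (hσ : σ ≤ κ₀ / (16 * (n : ℝ))) :
    Real.exp (σ * (4 * (((3 : ℝ) + 1) * n))) ≤ Real.exp κ₀ := by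
  have hn0 : (0 : ℝ) < (n : ℝ) := by exact_mod_cast Nat.pos_of_ne_zero (NeZero.ne n)
  refine Real.exp_le_exp.2 ?_
  have h : σ * (16 * (n : ℝ)) ≤ κ₀ := by
    have := mul_le_mul_of_nonneg_right hσ (by positivity : (0 : ℝ) ≤ 16 * (n : ℝ))
    rwa [div_mul_cancel₀ _ (by positivity : (16 * (n : ℝ)) ≠ 0)] at this
  nlinarith

end Record

/-! ## §6 The border table's product chart: the pair mass of `m^ρ_sym` is `≤ 3ℓ²` — again the number that bounds ONE entry (an1's `abs_symVhKerAt_le`) -/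

section Border

open Summit.QuantumFields.BalabanUV.Beta.SymAveragingHessianCounts (symLinCountAt symHessCountAt symVhCountAt symVhKerAt card_box)
open Summit.QuantumFields.BalabanUV.Beta.D1BFx.SymHessTablePairMass (sum_sum_abs_symHessCountAt_le sum_abs_symLinCountAt_le)
open Literature.MathematicalPhysics.QuantumFieldTheory.Balaban1983to89.Beta.AveragingHessianKernels (Bond ell le_ell)

variable {L : ℕ} {r : Fin d → ℕ}

/-- [folklore] **PAIR MASS OF `VH⁰⁴`**: `Σ_{f ∈ S₁} Σ_{f′ ∈ S₂} |symVhCountAt ρ L μ y f f′| ≤ 6·(d!)²·L^{2d}·ℓ²` (`L^d ×` §3's Hessian pair mass + the diagonal linear word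
+ the product of two linear single masses). -/
theorem sum_sum_abs_symVhCountAt_le (hL : 1 ≤ L) (hr : r ∈ box d L) (μ : Fin d) (y : Site d) (S₁ S₂ : Finset (Bond d)) :
    ∑ f ∈ S₁, ∑ f' ∈ S₂, |symVhCountAt (toSite r) L μ y f f'| ≤ 6 * (d ! : ℤ) ^ 2 * (L : ℤ) ^ (2 * d) * (ell d L : ℤ) ^ 2 := by
  classical
  have hℓ : (L : ℤ) ≤ ell d L := by exact_mod_cast le_ell
  have hL0 : (0 : ℤ) ≤ L := by positivity
  have hLd : (0 : ℤ) ≤ (L : ℤ) ^ d := by positivity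
  have hLd1 : (1 : ℤ) ≤ (L : ℤ) ^ d := by exact_mod_cast Nat.one_le_pow _ _ hL
  have hfac : (0 : ℤ) ≤ d ! := by positivity
  have hfac1 : (1 : ℤ) ≤ d ! := by exact_mod_cast Nat.one_le_iff_ne_zero.mpr (Nat.factorial_ne_zero d)
  have hℓ0 : (0 : ℤ) ≤ ell d L := hL0.trans hℓ
  have hH := sum_sum_abs_symHessCountAt_le hL hr μ y S₁ S₂
  have hA₁ := sum_abs_symLinCountAt_le hL hr μ y S₁
  have hA₂ := sum_abs_symLinCountAt_le hL hr μ y S₂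
  have hA₂n : 0 ≤ ∑ f ∈ S₂, |symLinCountAt (toSite r) L μ y f| := Finset.sum_nonneg fun _ _ => abs_nonneg _
  have h2d : (L : ℤ) ^ (2 * d) = (L : ℤ) ^ d * (L : ℤ) ^ d := by rw [two_mul, pow_add]
  -- the diagonal word, summed: at most `d!·Σ_f |symLin f|` for each `f′`-column? No — it is supported on the diagonal: sum over `f ∈ S₁` only.
  have hdiag : ∑ f ∈ S₁, ∑ f' ∈ S₂, |(if f = f' then (d ! : ℤ) * symLinCountAt (toSite r) L μ y f else 0)|
      ≤ (d ! : ℤ) * ((d ! : ℤ) * ((L : ℤ) ^ d * (ell d L : ℤ))) := by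
    calc ∑ f ∈ S₁, ∑ f' ∈ S₂, |(if f = f' then (d ! : ℤ) * symLinCountAt (toSite r) L μ y f else 0)|
        ≤ ∑ f ∈ S₁, (d ! : ℤ) * |symLinCountAt (toSite r) L μ y f| := by
          refine Finset.sum_le_sum fun f _ => ?_
          have h1 : ∀ f' ∈ S₂, |(if f = f' then (d ! : ℤ) * symLinCountAt (toSite r) L μ y f else 0)|
              = if f = f' then (d ! : ℤ) * |symLinCountAt (toSite r) L μ y f| else 0 := by
            intro f' _
            split_ifs
            · rw [abs_mul, abs_of_nonneg hfac]
            · rw [abs_zero]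
          rw [Finset.sum_congr rfl h1, Finset.sum_ite_eq]
          split_ifs
          · exact le_rfl
          · positivity
      _ = (d ! : ℤ) * ∑ f ∈ S₁, |symLinCountAt (toSite r) L μ y f| := by rw [Finset.mul_sum]
      _ ≤ (d ! : ℤ) * ((d ! : ℤ) * ((L : ℤ) ^ d * (ell d L : ℤ))) := mul_le_mul_of_nonneg_left hA₁ hfac
  have hterm : ∀ f f' : Bond d, |symVhCountAt (toSite r) L μ y f f'|
      ≤ (L : ℤ) ^ d * |symHessCountAt (toSite r) L μ y f f'|
        + (L : ℤ) ^ d * |(if f = f' then (d ! : ℤ) * symLinCountAt (toSite r) L μ y f else 0)|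
        + |symLinCountAt (toSite r) L μ y f| * |symLinCountAt (toSite r) L μ y f'| := by
    intro f f'
    rw [symVhCountAt]
    refine (abs_sub _ _).trans (add_le_add ((abs_add_le _ _).trans (add_le_add ?_ ?_)) ?_)
    · rw [abs_mul, abs_of_nonneg hLd]
    · rw [abs_mul, abs_of_nonneg hLd]
    · rw [abs_mul]
  calc ∑ f ∈ S₁, ∑ f' ∈ S₂, |symVhCountAt (toSite r) L μ y f f'|
      ≤ ∑ f ∈ S₁, ∑ f' ∈ S₂, ((L : ℤ) ^ d * |symHessCountAt (toSite r) L μ y f f'|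
        + (L : ℤ) ^ d * |(if f = f' then (d ! : ℤ) * symLinCountAt (toSite r) L μ y f else 0)|
        + |symLinCountAt (toSite r) L μ y f| * |symLinCountAt (toSite r) L μ y f'|) :=
        Finset.sum_le_sum fun f _ => Finset.sum_le_sum fun f' _ => hterm f f'
    _ = (L : ℤ) ^ d * (∑ f ∈ S₁, ∑ f' ∈ S₂, |symHessCountAt (toSite r) L μ y f f'|)
        + (L : ℤ) ^ d * (∑ f ∈ S₁, ∑ f' ∈ S₂, |(if f = f' then (d ! : ℤ) * symLinCountAt (toSite r) L μ y f else 0)|)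
        + (∑ f ∈ S₁, |symLinCountAt (toSite r) L μ y f|) * (∑ f' ∈ S₂, |symLinCountAt (toSite r) L μ y f'|) := by
        rw [Finset.sum_mul_sum, Finset.mul_sum, Finset.mul_sum, ← Finset.sum_add_distrib, ← Finset.sum_add_distrib]
        refine Finset.sum_congr rfl fun f _ => ?_
        rw [Finset.mul_sum, Finset.mul_sum, ← Finset.sum_add_distrib, ← Finset.sum_add_distrib]
    _ ≤ (L : ℤ) ^ d * (4 * (d ! : ℤ) ^ 2 * (L : ℤ) ^ d * (ell d L : ℤ) ^ 2)
        + (L : ℤ) ^ d * ((d ! : ℤ) * ((d ! : ℤ) * ((L : ℤ) ^ d * (ell d L : ℤ))))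
        + ((d ! : ℤ) * ((L : ℤ) ^ d * (ell d L : ℤ))) * ((d ! : ℤ) * ((L : ℤ) ^ d * (ell d L : ℤ))) :=
        add_le_add (add_le_add (mul_le_mul_of_nonneg_left hH hLd) (mul_le_mul_of_nonneg_left hdiag hLd))
          (mul_le_mul hA₁ hA₂ hA₂n (by positivity))
    _ ≤ 6 * (d ! : ℤ) ^ 2 * (L : ℤ) ^ (2 * d) * (ell d L : ℤ) ^ 2 := by
        rw [h2d]
        have h1 : (ell d L : ℤ) ≤ (ell d L : ℤ) ^ 2 := by nlinarith
        have h3 : (d ! : ℤ) ≤ (d ! : ℤ) ^ 2 := by nlinarith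
        nlinarith [mul_nonneg (mul_nonneg hLd hLd) (mul_nonneg hfac hℓ0), mul_nonneg hLd hLd,
          mul_le_mul h3 h1 hℓ0 (by positivity : (0:ℤ) ≤ (d ! : ℤ) ^ 2)]

/-- [folklore] **PAIR `ℓ¹` MASS OF THE BORDER TABLE `m^ρ_sym`: `Σ_{f ∈ S₁} Σ_{f′ ∈ S₂} |symVhKerAt (toSite r) L μ y f f′| ≤ 3ℓ²`** (box root, `1 ≤ L`) — the number of an1's
entrywise `abs_symVhKerAt_le`. -/
theorem sum_sum_abs_symVhKerAt_le (hL : 1 ≤ L) (hr : r ∈ box d L) (μ : Fin d) (y : Site d) (S₁ S₂ : Finset (Bond d)) :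
    ∑ f ∈ S₁, ∑ f' ∈ S₂, |symVhKerAt (toSite r) L μ y f f'| ≤ 3 * (ell d L : ℝ) ^ 2 := by
  have hfac : (0 : ℝ) < (d ! : ℝ) := by exact_mod_cast Nat.factorial_pos d
  have hden : (0 : ℝ) < 2 * (d ! : ℝ) ^ 2 * (L : ℝ) ^ (2 * d) := by positivity
  have h := sum_sum_abs_symVhCountAt_le hL hr μ y S₁ S₂
  have h' : (∑ f ∈ S₁, ∑ f' ∈ S₂, |(symVhCountAt (toSite r) L μ y f f' : ℝ)|) ≤ 6 * (d ! : ℝ) ^ 2 * (L : ℝ) ^ (2 * d) * (ell d L : ℝ) ^ 2 := by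
    exact_mod_cast h
  have e : ∀ f f' : Bond d, |symVhKerAt (toSite r) L μ y f f'| = |(symVhCountAt (toSite r) L μ y f f' : ℝ)| / (2 * (d ! : ℝ) ^ 2 * (L : ℝ) ^ (2 * d)) := by
    intro f f'
    rw [symVhKerAt, abs_div, abs_of_pos hden]
  simp_rw [e, ← Finset.sum_div]
  rw [div_le_iff₀ hden]
  nlinarith

end Border

/-! ## §7 `d = 3`: the FULL-fibre weighted mass of `V_H` in d1-leaf-03's `MV` shape — `n⁻⁸ × 2·ell(4,n)² × (multiplier constants)` -/

section Full

open B12Sec2to5 (l1)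
open B4ContourShift (supNorm)
open ExpKernelCalculus (Zl MKer)
open KernelSpecInstance (wΦ)
open OneStepResolventKernel (Fib)
open OneStepKernelFamily (KInvStep)
open SecondOrderResponse (vertexOfM)
open AveragingContoursRooted (ctr)
open Summit.QuantumFields.BalabanUV.Beta.SymAveragingHessianCounts (symHessFFAt)
open Summit.QuantumFields.BalabanUV.Beta.D1BFx.PackedKernelSplit (blk)

/-- [folklore] **FULL WEIGHTED MASS FROM WEIGHTED BLOCK MASSES** (`d = 3`; the weighted sibling of g62 F4 `StraightPinRestRow.fibreMass_le_of_blk` and of d1-leaf-03's pending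
`DiagBracketWordMass.wmass_le_of_blk` — neither importable here without the olean lane; 12 lines): summable weighted block masses `≤ B j k` give a summable weighted full
mass `≤ (B tt + B tf) + (B ft + B ff)`. -/
theorem wfibreMass_le_of_blk {W : MKer 4 (Fib 3)} (w : Site (3 + 1) × Site (3 + 1) → ℝ) {B : Bool → Bool → ℝ}
    (h : ∀ j k : Bool, (Summable fun q : Site (3 + 1) × Site (3 + 1) => ∑ g, ∑ f, |blk W j k q.1 q.2 g f| * w q) ∧
      ∑' q : Site (3 + 1) × Site (3 + 1), ∑ g, ∑ f, |blk W j k q.1 q.2 g f| * w q ≤ B j k) :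
    (Summable fun q : Site (3 + 1) × Site (3 + 1) => (∑ a : Fib 3, ∑ b : Fib 3, |W q.1 q.2 a b|) * w q) ∧
      ∑' q : Site (3 + 1) × Site (3 + 1), (∑ a : Fib 3, ∑ b : Fib 3, |W q.1 q.2 a b|) * w q
        ≤ (B true true + B true false) + (B false true + B false false) := by
  have e : (fun q : Site (3 + 1) × Site (3 + 1) => (∑ a : Fib 3, ∑ b : Fib 3, |W q.1 q.2 a b|) * w q)
      = fun q => ((∑ g, ∑ f, |blk W true true q.1 q.2 g f| * w q) + ∑ g, ∑ f, |blk W true false q.1 q.2 g f| * w q)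
        + ((∑ g, ∑ f, |blk W false true q.1 q.2 g f| * w q) + ∑ g, ∑ f, |blk W false false q.1 q.2 g f| * w q) := by
    funext q
    simp only [PackedKernelSplit.blk, PackedKernelSplit.inj, ← Finset.sum_mul]
    rw [Fintype.sum_sum_type, add_mul]
    congr 1
    · rw [← add_mul, ← Finset.sum_add_distrib]
      exact congrArg (· * w q) (Finset.sum_congr rfl fun g _ => Fintype.sum_sum_type _)
    · rw [← add_mul, ← Finset.sum_add_distrib]
      exact congrArg (· * w q) (Finset.sum_congr rfl fun g _ => Fintype.sum_sum_type _)
  rw [e]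
  have htt := h true true
  have htf := h true false
  have hft := h false true
  have hff := h false false
  refine ⟨(htt.1.add htf.1).add (hft.1.add hff.1), ?_⟩
  rw [(htt.1.add htf.1).tsum_add (hft.1.add hff.1), htt.1.tsum_add htf.1, hft.1.tsum_add hff.1]
  exact add_le_add (add_le_add htt.2 htf.2) (add_le_add hft.2 hff.2)

variable (n : ℕ) [NeZero n]

/-- [our objects + folklore] **THE `MV` LETTER OF `V_H` WITH THE PAIR MASS** (d1-leaf-03 TT27b `wmass_vertexOfM_K₀_symHessFFAt_le`'s LEFT-HAND SIDE, a smaller right-hand side):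
`Σ'_{pr} (Σ_{a b} |vertexOfM K₀ n (symHessFFAt ρ_c n) ν y′ pr.1 pr.2 a b|)·e^{σ(|pr.1 − n•y′|₁ + |pr.2 − n•y′|₁)} ≤ ((n⁵)⁻¹(n³)⁻¹)·(4CΦe^{κ₀}e^{κ₀∕2}Zl 4(κ₀∕8))·(2·ell(4,n)²·e^{σ·4·(4n)})`
(modulo `hΦ`; `0 ≤ σ ≤ κ₀∕(16n)`; NO second rate `δM`, NO lattice volume at a fine rate). -/
theorem wmass_vertexOfM_K₀_symHessFFAt_le_pairMass {CΦ κ₀ : ℝ} (hκ₀ : 0 < κ₀)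
    (hΦ : ∀ (ρ ν : Fin (3 + 1)) (w : Fin (3 + 1) → ℤ),
      |wΦ (N := n) ρ ν w| ≤ CΦ * ((n : ℝ) ^ 5)⁻¹ * ((n : ℝ) ^ 3)⁻¹ * Real.exp (-(κ₀ * supNorm w)))
    {σ : ℝ} (hσ0 : 0 ≤ σ) (hσ : σ ≤ κ₀ / (16 * (n : ℝ))) (ν : Fin (3 + 1)) (y' : Site (3 + 1)) :
    (Summable fun pr : Site (3 + 1) × Site (3 + 1) =>
        (∑ a : Fib 3, ∑ b : Fib 3, |vertexOfM (KInvStep (d := 3) n 0) n (symHessFFAt (ctr 4 n) n) ν y' pr.1 pr.2 a b|)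
          * Real.exp (σ * (l1 (pr.1 - (n : ℤ) • y') + l1 (pr.2 - (n : ℤ) • y')))) ∧
      ∑' pr : Site (3 + 1) × Site (3 + 1),
          (∑ a : Fib 3, ∑ b : Fib 3, |vertexOfM (KInvStep (d := 3) n 0) n (symHessFFAt (ctr 4 n) n) ν y' pr.1 pr.2 a b|)
            * Real.exp (σ * (l1 (pr.1 - (n : ℤ) • y') + l1 (pr.2 - (n : ℤ) • y')))
        ≤ (((n : ℝ) ^ 5)⁻¹ * ((n : ℝ) ^ 3)⁻¹) * (4 * CΦ * Real.exp κ₀ * Real.exp (κ₀ / 2) * Zl 4 (κ₀ / 8))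
            * (2 * (ell (3 + 1) n : ℝ) ^ 2 * Real.exp (σ * (4 * (((3 : ℝ) + 1) * n)))) := by
  have hblk := fun j k => wmass_blk_vertexOfM_K₀_symHessFFAt_le n hκ₀ hΦ hσ0 hσ ν y' j k
  have h := wfibreMass_le_of_blk (W := vertexOfM (KInvStep (d := 3) n 0) n (symHessFFAt (ctr 4 n) n) ν y')
    (fun q : Site (3 + 1) × Site (3 + 1) => Real.exp (σ * (l1 (q.1 - (n : ℤ) • y') + l1 (q.2 - (n : ℤ) • y'))))
    (B := fun j k => (((n : ℝ) ^ 5)⁻¹ * ((n : ℝ) ^ 3)⁻¹) * (4 * CΦ * Real.exp κ₀ * Real.exp (κ₀ / 2) * Zl 4 (κ₀ / 8))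
      * (if j = true ∧ k = true then 2 * (ell (3 + 1) n : ℝ) ^ 2 * Real.exp (σ * (4 * (((3 : ℝ) + 1) * n))) else 0)) hblk
  refine ⟨h.1, h.2.trans (le_of_eq ?_)⟩
  simp

end Full

end Summit.QuantumFields.BalabanUV.Beta.D1BFx.SymHessTableMass

end
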